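import Summits.ABC.IUTFork.Joshi.ATS4RamificationDivisorsPrimes
import Summits.ABC.IUTFork.Joshi.ATS4DescentSpineAbcThetaDivision
import Literature.NumberTheory.LFunctions.MertensElementary
import Literature.NumberTheory.LFunctions.RosserSchoenfeldMertensChainSound
import Literature.NumberTheory.LFunctions.RosserSchoenfeldMertensChainRun1
import HarnessLib

/-!
# [J-IV] (arXiv:2403.10430v2) Lemma 6.7.8 «e*_mod·log(s^≤) ≤ (4/3)(e*_mod·ℓ + η_prm)» AT THE GENUINE `s^≤` OF (6.7.5)–(6.7.6):
# DERIVED whenever `log(4·e*_mod·ℓ) ≤ (4/3)ℓ` (so off an exceptional set of bounded height in the E5 spine), REFUTED as a blanket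
# statement at `ℓ = 7` — R-J census row Y-21g

Proof-only companion (0 defs) of the abc-iut cell, branch E / R-J «Joshi Y-discharge census» (rung LADDER-ABC:A2.RESCUE.J; D-0079),
seat abc-iut-E-t30 (gen 5), row Y-21g of `HOME/plan/E/R-J/Y-CENSUS.tsv` (letter g = `LocusVolumeDatum.Lem678`). Parents BUILT, every
input BY NAME: E-t31's carrier `LocusVolumeDatum` with the reading predicate `Lem678` (`Joshi/ATS4LocusUpperBounds.lean`, p430311),
E-t31's §6.6–§6.7 signature `PrimeTowerDatum` with `iota` (6.7.5), `logSleQAt` / `logSleQ` (6.7.6)–(6.7.7) for `L* = ℚ`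
(`Joshi/ATS4RamificationDivisors.lean`, p430536) and the dictionary `PrimeTowerDatum.TowerGlue` (`Joshi/ATS4RamificationDivisorsPrimes.lean`);
T-29's `IsLem587Prime` / E-t29's `exists_threshold_P1_to_P6`; the tree's Mertens–Chebyshev bound
`Literature.NumberTheory.LFunctions.MertensBound.sum_log_div_prime_le` («Σ_{p ≤ n} (log p)/p ≤ log n + log 4», Hardy–Wright Thm. 425
from Chebyshev's `θ(n) ≤ n·log 4`) and the kernel-certified Rosser–Schoenfeld (3.21)-chain state `MertensChainRun.run1`
(`Σ_{p ≤ 224743} (log p)/p ≥ 13289279305558884756923127·2⁻⁸⁰ = 10.99…`, `RosserSchoenfeldMertensChainRun1.lean` /`…ChainSound.lean`).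
SOURCE: K. Joshi, *Construction of Arithmetic Teichmüller Spaces IV*, arXiv:2403.10430v2 (unrefereed; bib `Joshi2024ATS4`), p.62
l.1–32 of the cell's render `HOME/lit/renders/Joshi-arxiv-2403.10430/p0062.txt`: «(6.7.5) ι_v = 1 if p_v ≤ e*_mod·ℓ, 0 otherwise.
(6.7.6) s^≤_{L*} = Σ_{v ∈ V^dst_{L*}} (ι_v/p_v)·v … Lemma 6.7.8. Under the notations and assumptions of Theorem 6.1.1, one has
e*_mod·log(s^≤) ≤ (4/3)(e*_mod·ℓ + η_prm). Proof. Since s^≤ is supported on primes ≤ e*_mod·ℓ, this is a straight forward argument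
using the definition of s^≤ of equation (6.7.6) and is given in [Mochizuki, 2021d, Page 660] using definitions and basic explicit
estimate §6.2 for the prime counting function.»; Prop. 6.2.1 p.58 («η_prm := 60»); p.72 l.31 («Finally one uses ℓ ≥ 7»). [IUTchIV]
Thm. 1.10 Step (viii) (the cited page) reads instead `s^≤ := Σ (ι_v/log(p_v))·v` and `l*_mod := log(e*_mod·l)` — the tree's
`Literature.IUT.LogVolume.Thm110Numerics.ProofData.sLe_le` / `Theorem110.stepviii_pnt`, PROVED with `isEtaPrm_sixty`.

FRAMING (binding): real-number / prime-number statements about a TYPED reading predicate, PROVED. NO side is taken on [IUTchIII]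
Cor. 3.12 / [IUTchIV] Thm. 1.10, on Joshi's claims or on Mochizuki's report on them; NO abc claim; typed ≠ proved ≠ endorsed. A
located discrepancy between a printed lemma and its genuine reading is recorded with its repair, nothing more.

THE ROW. In the E5 spine (`abc_of_thetaTowerDescentInputs` p443293 / `abc_of_descentInputs_exists` p447878) Lemma 6.7.8 is the
hypothesis `dd.Lem678 : e*·log(s^≤) ≤ (4/3)(e*·ℓ + η)` on E-t31's carrier, whose `log(s^≤)` slot is a FREE real; the R-J question
(Y-21g) is whether it is derivable «from FACT + typed [J-IV]» AT THE GENUINE `s^≤`, i.e. when the slot is read through E-t31's own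
§6.7 dictionary `TowerGlue` as (6.7.6)–(6.7.7) over `ℚ`: `log(s^≤_ℚ) = Σ_{p ∈ V^dst_ℚ} (ι_p/p)·log p`, `ι_p = [p ≤ e*_mod·ℓ]`. ANSWER
(kernel, this file):
1. `TowerGlue.estar_mul_logsLe_le` — at every tower-glued carrier with prime residue characteristics,
   `e*·log(s^≤_ℚ) ≤ e*·(log(e*·ℓ) + log 4)` UNCONDITIONALLY (`V^dst_ℚ ∩ [0, e*ℓ] ⊆ primes ≤ e*ℓ` and Mertens–Chebyshev).
2. `TowerGlue.lem678_of_room` — **DERIVED**: `Lem678` holds at the genuine `s^≤` whenever `log(4·e*_mod·ℓ) ≤ (4/3)·ℓ` (any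
   `η_prm ≥ 0`, any `V^dst`); `lem678Room_of_le` — the room holds as soon as `ℓ ≥ 3·log(4·e*_mod)` … so for `e_mod = 1` at every
   `ℓ ≥ 44`, and in general above an explicit threshold logarithmic in `e*_mod`.
3. `TowerGlue.not_lem678_of_small_l` — **REFUTED AS A BLANKET STATEMENT**: at every tower-glued carrier with `e*_mod = 2¹²·3³·5`
   (`e_mod = 1`), `ℓ ≤ 7`, `η_prm ≤ 10⁵` and `V^dst_ℚ ⊇ {p prime : p ≤ 224743}`, `Lem678` is FALSE:
   `e*·log(s^≤_ℚ) ≥ 552960·Σ_{p ≤ 224743}(log p)/p ≥ 552960·10.99 > (4/3)(552960·7 + 10⁵)`. `exists_towerGlue_not_lem678` — an explicit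
   such pair `(T, d)` over E-t31's signatures (`ℓ = 7`, `d_mod = 1`, `η_prm = 60`, prime residue characteristics, `V^dst_ℚ` = the primes
   `≤ 224743`), so the reading predicate glued to (6.7.6) is NOT a theorem of the signature. Arithmetic meaning (recorded, not
   kernel-checked): `V^dst_ℚ ⊇ {p ≤ 224743}` is realised by the λ-line point `λ = 1 + Π_{p ≤ 224743} p ∈ ℚ` (`d = 1`, `L_mod = ℚ`,
   `e_mod = 1`): `C_λ : y² = x(x−1)(x−λ)` has split multiplicative reduction at every odd `p ≤ 224743` (`λ ≡ 1 mod p`), so these primes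
   lie under `Supp(q_L)` and belong to `V^dst_ℚ` by Lemma 6.7.1 (4) ⟹ (1); `2 ∣ 30ℓ`.
4. `exists_isLem587Prime_lem678Room_offExc` — **THE REPAIR IN THE SPINE**: for `Z` with (5.6.2) and `d ≥ 1`, off an exceptional
   set OF BOUNDED HEIGHT every `λ ∈ Z ∩ U(Q̄)_{≤d}` carries a prime `ℓ` of Lemma 5.8.7 with `ITDConditions`, `AdmitsCore` AND the room
   `log(4·2¹²·3³·5·d·ℓ) ≤ (4/3)·ℓ` (the window `ℓ ≥ Q^{1/2}` of Lemma 5.8.7 and `e_mod ≤ d_mod ≤ d`): there item 2 discharges `Lem678` at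
   the genuine `s^≤` of every glued carrier with `e*_mod ≤ 2¹²·3³·5·d` (`lem678_of_room_of_estar_le`). So in the E5 spine letter g is
   a THEOREM off `Exc` (as [IUTchIV]'s Step (viii) is a theorem outright), and print's Lemma 6.7.8 is located as MIS-STATED at
   `ℓ ∈ {5, 7}` for `e_mod = 1` and large `V^dst_ℚ` (repair: add «for ℓ ≥ 3·log(4·e*_mod)», or read (6.7.6) with [IUTchIV]'s
   coefficient `ι_v/log(p_v)` and `l*_mod`). Numbers for `e_mod = 1`: refuted at `ℓ = 5, 7`; derived for every prime `ℓ ≥ 13` (room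
   `log(4·552960·13) = 17.17 ≤ 17.33`); `ℓ = 11` is decided by neither bound of this file (true margin ≈ 2.6 % by Rosser–Schoenfeld
   (3.22), finer than Chebyshev's `log 4`).
FACT rows used: none (Mathlib's Chebyshev bound, the tree's PROVED Mertens–Chebyshev inequality and its kernel-certified (3.21)
chain). Theorems only; standard axioms; no `sorry`, instance, notation, `def` or new `Prop`. [claim: Joshi2024ATS4, status: disputed]
for the locators.
-/

noncomputable section

namespace Summit.ABC.IUTFork.Joshi.ATS4

open Finset
open Literature.NumberTheory.LFunctions

namespace PrimeTowerDatum

variable (T : PrimeTowerDatum)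

/-! ## 1. The genuine `log(s^≤_ℚ)` of (6.7.6)–(6.7.7) against the prime sums `Σ (log p)/p` -/

/-- The `v_ℚ`-component of `log(s^≤_ℚ)` is `≥ 0`. [folklore] -/
theorem logSleQAt_nonneg (p : ℕ) : 0 ≤ T.logSleQAt p :=
  mul_nonneg (div_nonneg (T.iota_nonneg p) (Nat.cast_nonneg _)) (Real.log_natCast_nonneg _)

/-- At `p ≤ e*_mod·ℓ` the component is `(log p)/p` (`ι_p = 1`, (6.7.5)). [claim: Joshi2024ATS4, status: disputed] -/
theorem logSleQAt_of_le {p : ℕ} (hp : p ≤ T.estar * T.l) : T.logSleQAt p = Real.log p / p := by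
  unfold logSleQAt iota
  rw [if_pos hp]
  ring

/-- Beyond `e*_mod·ℓ` the component vanishes (`ι_p = 0`; «s^≤ is supported on primes ≤ e*_mod·ℓ», p.62 l.28).
[claim: Joshi2024ATS4, status: disputed] -/
theorem logSleQAt_of_lt {p : ℕ} (hp : T.estar * T.l < p) : T.logSleQAt p = 0 := by
  unfold logSleQAt iota
  rw [if_neg (not_le.mpr hp)]
  ring

/-- **UPPER comparison**: with prime residue characteristics, `log(s^≤_ℚ) ≤ Σ_{p ≤ e*_mod·ℓ, p prime} (log p)/p` (the support of
`s^≤_ℚ` is a set of primes `≤ e*_mod·ℓ`). [claim: Joshi2024ATS4, status: disputed] -/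
theorem logSleQ_le_sum_primesLE (hc : ∀ v : T.Pmod, (T.char v).Prime) :
    T.logSleQ ≤ ∑ p ∈ Nat.primesLE (T.estar * T.l), Real.log p / p := by
  classical
  unfold logSleQ
  -- split off the primes beyond `e*ℓ`, whose components vanish
  have hsplit : ∑ p ∈ T.vdstQFinset, T.logSleQAt p =
      ∑ p ∈ T.vdstQFinset.filter (fun p => p ≤ T.estar * T.l), T.logSleQAt p := by
    rw [← Finset.sum_filter_add_sum_filter_not T.vdstQFinset (fun p => p ≤ T.estar * T.l)]
    have h0 : ∑ p ∈ T.vdstQFinset.filter (fun p => ¬ p ≤ T.estar * T.l), T.logSleQAt p = 0 :=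
      Finset.sum_eq_zero fun p hp => T.logSleQAt_of_lt (not_le.mp (Finset.mem_filter.mp hp).2)
    rw [h0, add_zero]
  rw [hsplit]
  have hsub : T.vdstQFinset.filter (fun p => p ≤ T.estar * T.l) ⊆ Nat.primesLE (T.estar * T.l) := by
    intro p hp
    rw [Finset.mem_filter, mem_vdstQFinset] at hp
    exact Nat.mem_primesLE.mpr ⟨hp.2, T.prime_of_mem_vdstQ hc hp.1⟩
  calc ∑ p ∈ T.vdstQFinset.filter (fun p => p ≤ T.estar * T.l), T.logSleQAt p
      = ∑ p ∈ T.vdstQFinset.filter (fun p => p ≤ T.estar * T.l), Real.log p / p :=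
        Finset.sum_congr rfl fun p hp => T.logSleQAt_of_le (Finset.mem_filter.mp hp).2
    _ ≤ ∑ p ∈ Nat.primesLE (T.estar * T.l), Real.log p / p :=
        Finset.sum_le_sum_of_subset_of_nonneg hsub fun p _ _ =>
          div_nonneg (Real.log_natCast_nonneg _) (Nat.cast_nonneg _)

/-- **LOWER comparison**: if `V^dst_ℚ` contains every prime `≤ N` and `N ≤ e*_mod·ℓ`, then `Σ_{p ≤ N}(log p)/p ≤ log(s^≤_ℚ)`.
[claim: Joshi2024ATS4, status: disputed] -/
theorem sum_primesLE_le_logSleQ {N : ℕ} (hN : N ≤ T.estar * T.l) (hV : ∀ p : ℕ, p.Prime → p ≤ N → p ∈ T.VdstQ) :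
    ∑ p ∈ Nat.primesLE N, Real.log p / p ≤ T.logSleQ := by
  classical
  unfold logSleQ
  have hsub : Nat.primesLE N ⊆ T.vdstQFinset := by
    intro p hp
    rw [mem_vdstQFinset]
    exact hV p (Nat.prime_of_mem_primesLE hp) (Nat.le_of_mem_primesLE hp)
  calc ∑ p ∈ Nat.primesLE N, Real.log p / p = ∑ p ∈ Nat.primesLE N, T.logSleQAt p :=
        Finset.sum_congr rfl fun p hp => (T.logSleQAt_of_le ((Nat.le_of_mem_primesLE hp).trans hN)).symm
    _ ≤ ∑ p ∈ T.vdstQFinset, T.logSleQAt p :=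
        Finset.sum_le_sum_of_subset_of_nonneg hsub fun p _ _ => T.logSleQAt_nonneg p

/-- **Mertens–Chebyshev at the genuine `s^≤`**: `log(s^≤_ℚ) ≤ log(e*_mod·ℓ) + log 4` (prime residue characteristics, `e*_mod·ℓ ≥ 1`),
by the tree's `MertensBound.sum_log_div_prime_le` (Hardy–Wright Thm. 425 from `θ(n) ≤ n·log 4`). PROVED. [folklore] -/
theorem logSleQ_le_log (hc : ∀ v : T.Pmod, (T.char v).Prime) :
    T.logSleQ ≤ Real.log ((T.estar * T.l : ℕ) : ℝ) + Real.log 4 :=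
  (T.logSleQ_le_sum_primesLE hc).trans (MertensBound.sum_log_div_prime_le _)

/-- **The kernel-certified lower value**: `Σ_{p ≤ 224743} (log p)/p ≥ 13289279305558884756923127·2⁻⁸⁰` (`= 10.993…`), read off the
state of the tree's certified Rosser–Schoenfeld (3.21)-chain after its first chunk (`MertensChainRun.run1`, invariant
`MertensChain.Inv.Slo_le`). PROVED (by the tree's kernel computation). [cite: RosserSchoenfeld1962, Thm. 6 (3.21); p. 76] -/
theorem sum_primesLE_224743_ge :
    (13289279305558884756923127 : ℝ) / 2 ^ 80 ≤ ∑ p ∈ Nat.primesLE 224743, Real.log p / p := by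
  have hI := MertensChain.runD_sound MertensChain.initS_inv MertensChainRun.run1
  have h := hI.Slo_le
  simp only [Mertens.primeLogDivSum, Nat.cast_ofNat, Nat.floor_ofNat] at h
  rw [div_le_iff₀ (by positivity)]
  linarith

namespace TowerGlue

variable {T} {d : LocusVolumeDatum} (G : TowerGlue T d)
include G

/-! ## 2. DERIVED: Lemma 6.7.8 at the genuine `s^≤` whenever `log(4·e*_mod·ℓ) ≤ (4/3)ℓ` -/

/-- **`e*·log(s^≤_ℚ) ≤ e*·(log(e*·ℓ) + log 4)` at every tower-glued carrier** whose `e*_mod` is the tower's (prime residue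
characteristics). PROVED — unconditional; any `V^dst`. [claim: Joshi2024ATS4, status: disputed] -/
theorem estar_mul_logsLe_le (hc : ∀ v : T.Pmod, (T.char v).Prime) (he : d.estar = (T.estar : ℝ)) :
    d.estar * d.logsLe ≤ d.estar * (Real.log (d.estar * d.l) + Real.log 4) := by
  have he0 : 0 ≤ d.estar := le_trans (by norm_num) d.estar_ge
  refine mul_le_mul_of_nonneg_left ?_ he0
  rw [G.logsLe_eq, he, G.l_eq, ← Nat.cast_mul]
  exact T.logSleQ_le_log hc

/-- **Lemma 6.7.8 DERIVED at the genuine `s^≤` under the room `log(4·e*_mod·ℓ) ≤ (4/3)·ℓ`** (any `η_prm ≥ 0`, any `V^dst_ℚ`): from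
item 1, `e*·log(s^≤) ≤ e*·log(4·e*·ℓ) ≤ (4/3)·e*·ℓ ≤ (4/3)(e*·ℓ + η_prm)`. PROVED. [claim: Joshi2024ATS4, status: disputed] -/
theorem lem678_of_room (hc : ∀ v : T.Pmod, (T.char v).Prime) (he : d.estar = (T.estar : ℝ))
    (hroom : Real.log (4 * (d.estar * d.l)) ≤ 4 / 3 * d.l) : d.Lem678 := by
  unfold LocusVolumeDatum.Lem678
  have he0 : 0 ≤ d.estar := le_trans (by norm_num) d.estar_ge
  have hepos : 0 < d.estar := lt_of_lt_of_le (by norm_num) d.estar_ge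
  have hl : (0 : ℝ) < d.l := lt_of_lt_of_le (by norm_num) d.five_le_l_real
  have h1 := G.estar_mul_logsLe_le hc he
  have hlog : Real.log (4 * (d.estar * d.l)) = Real.log 4 + Real.log (d.estar * d.l) :=
    Real.log_mul (by norm_num) (by positivity)
  have h1' : d.estar * d.logsLe ≤ d.estar * Real.log (4 * (d.estar * d.l)) := by rw [hlog]; linarith
  have h2 : d.estar * Real.log (4 * (d.estar * d.l)) ≤ d.estar * (4 / 3 * d.l) := mul_le_mul_of_nonneg_left hroom he0
  have hη := d.eta_nonneg
  nlinarith

omit G in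
/-- **The room from a lower bound on `ℓ`**: `log(4·e*_mod·ℓ) ≤ (4/3)·ℓ` as soon as `3·log(4·e*_mod) ≤ ℓ` (using `log ℓ ≤ ℓ − 1`). In
particular for `e_mod = 1` (`e*_mod = 552960`, `3·log(2211840) = 43.8…`) at every `ℓ ≥ 44`. PROVED. [folklore] -/
theorem _root_.Summit.ABC.IUTFork.Joshi.ATS4.LocusVolumeDatum.lem678Room_of_le (d : LocusVolumeDatum)
    (h : 3 * Real.log (4 * d.estar) ≤ d.l) : Real.log (4 * (d.estar * d.l)) ≤ 4 / 3 * d.l := by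
  have hepos : 0 < d.estar := lt_of_lt_of_le (by norm_num) d.estar_ge
  have hl : (0 : ℝ) < d.l := lt_of_lt_of_le (by norm_num) d.five_le_l_real
  have hsplit : Real.log (4 * (d.estar * d.l)) = Real.log (4 * d.estar) + Real.log d.l := by
    rw [show 4 * (d.estar * d.l) = (4 * d.estar) * d.l by ring, Real.log_mul (by positivity) hl.ne']
  have hlogl : Real.log (d.l : ℝ) ≤ d.l - 1 := Real.log_le_sub_one_of_pos hl
  rw [hsplit]
  linarith

/-- **Lemma 6.7.8 at the genuine `s^≤` from `ℓ ≥ 3·log(4·e*_mod)`** (items above composed). PROVED.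
[claim: Joshi2024ATS4, status: disputed] -/
theorem lem678_of_le (hc : ∀ v : T.Pmod, (T.char v).Prime) (he : d.estar = (T.estar : ℝ))
    (h : 3 * Real.log (4 * d.estar) ≤ d.l) : d.Lem678 :=
  G.lem678_of_room hc he (d.lem678Room_of_le h)

/-- **Lemma 6.7.8 at the genuine `s^≤` for glued carriers with `e*_mod ≤ 2¹²·3³·5·D` under the room stated with `D`** (the form the
E5 spine uses: there `e*_mod = 2¹²·3³·5·e_mod` with `e_mod ≤ d_mod ≤ d`, and the room in `d` is supplied off `Exc` by
`exists_isLem587Prime_lem678Room_offExc`). PROVED. [claim: Joshi2024ATS4, status: disputed] -/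
theorem lem678_of_room_of_estar_le (hc : ∀ v : T.Pmod, (T.char v).Prime) (he : d.estar = (T.estar : ℝ)) {D : ℕ}
    (hD : d.estar ≤ 2 ^ 12 * 3 ^ 3 * 5 * (D : ℝ)) (hroom : Real.log (4 * (2 ^ 12 * 3 ^ 3 * 5 * (D : ℝ) * d.l)) ≤ 4 / 3 * d.l) :
    d.Lem678 := by
  refine G.lem678_of_room hc he (le_trans ?_ hroom)
  have hepos : 0 < d.estar := lt_of_lt_of_le (by norm_num) d.estar_ge
  have hl : (0 : ℝ) < d.l := lt_of_lt_of_le (by norm_num) d.five_le_l_real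
  exact Real.log_le_log (by positivity) (by nlinarith)

/-! ## 3. REFUTED as a blanket statement: `ℓ ≤ 7`, `e_mod = 1`, `V^dst_ℚ ⊇ {p ≤ 224743}` -/

/-- **Lemma 6.7.8 FAILS at the genuine `s^≤`** of every tower-glued carrier with `e*_mod = 2¹²·3³·5 = 552960` (`e_mod = 1`),
`ℓ ≤ 7` (so in particular at print's minimal `ℓ = 7`, p.72 l.31, and at `ℓ = 5`), `η_prm ≤ 10⁵` (print: `η_prm = 60`) and
`V^dst_ℚ ⊇ {p prime : p ≤ 224743}`: `e*·log(s^≤_ℚ) ≥ 552960·Σ_{p ≤ 224743}(log p)/p ≥ 552960·13289279305558884756923127·2⁻⁸⁰ >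
(4/3)·(552960·7 + 10⁵) ≥ (4/3)(e*·ℓ + η_prm)`. PROVED (the middle value is the tree's kernel-certified (3.21)-chain state).
[claim: Joshi2024ATS4, status: disputed] -/
theorem not_lem678_of_small_l (he : d.estar = (T.estar : ℝ)) (hE : T.estar = 2 ^ 12 * 3 ^ 3 * 5) (hl7 : d.l ≤ 7)
    (hη : d.eta ≤ 100000) (hV : ∀ p : ℕ, p.Prime → p ≤ 224743 → p ∈ T.VdstQ) : ¬ d.Lem678 := by
  unfold LocusVolumeDatum.Lem678
  intro h
  have hl5 : 5 ≤ T.l := G.l_eq ▸ d.five_le_l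
  have hN : 224743 ≤ T.estar * T.l := by
    rw [hE]; calc (224743 : ℕ) ≤ 2 ^ 12 * 3 ^ 3 * 5 * 5 := by norm_num
      _ ≤ 2 ^ 12 * 3 ^ 3 * 5 * T.l := Nat.mul_le_mul_left _ hl5
  have hlow : (13289279305558884756923127 : ℝ) / 2 ^ 80 ≤ d.logsLe := by
    rw [G.logsLe_eq]
    exact sum_primesLE_224743_ge.trans (T.sum_primesLE_le_logSleQ hN hV)
  have hEr : d.estar = 552960 := by rw [he, hE]; norm_num
  have hl7r : (d.l : ℝ) ≤ 7 := by exact_mod_cast hl7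
  rw [hEr] at h
  have h2 : (552960 : ℝ) * (13289279305558884756923127 / 2 ^ 80) ≤ 552960 * d.logsLe :=
    mul_le_mul_of_nonneg_left hlow (by norm_num)
  nlinarith

end TowerGlue

end PrimeTowerDatum

/-! ## 4. An explicit glued pair where Lemma 6.7.8 fails (so the glued reading predicate is not a theorem of the signature) -/

/-- **A tower-glued carrier at which Lemma 6.7.8 (genuine `s^≤`, Joshi's coefficients) is FALSE.** Over E-t31's signatures: the tower
read at the level of rational primes (every prime type `Nat.Primes`, restrictions the identity, residue characteristic = the prime,
`e = f = 1`, `d_mod = 1`, `e*_mod = 2¹²·3³·5`, `ℓ = 7`, `Supp` empty, `L′` ramified exactly above the primes `≤ 224743`, whence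
`V^dst_ℚ = {p prime : p ≤ 224743}`), and the carrier with `ℓ = 7`, `d_mod = 1`, `e*_mod = 2¹²·3³·5`, `η_prm = 60`, its §6.7 slots READ
THROUGH `TowerGlue` (all other slots, irrelevant to `Lem678`, set to `0` / `1`). PROVED. (Arithmetic meaning, not kernel-checked here:
`V^dst_ℚ ⊇ {p ≤ 224743}` is realised on the λ-line by `λ = 1 + Π_{p ≤ 224743} p`, of split multiplicative reduction at every odd
`p ≤ 224743`.) [claim: Joshi2024ATS4, status: disputed] -/
theorem exists_towerGlue_not_lem678 :
    ∃ (T : PrimeTowerDatum) (d : LocusVolumeDatum), (∀ v : T.Pmod, (T.char v).Prime) ∧ PrimeTowerDatum.TowerGlue T d ∧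
      T.l = 7 ∧ d.l = 7 ∧ T.dmod = 1 ∧ d.dmod = 1 ∧ T.estar = 2 ^ 12 * 3 ^ 3 * 5 ∧ d.estar = 2 ^ 12 * 3 ^ 3 * 5 ∧ d.eta = 60 ∧
      (∀ p : ℕ, p ∈ T.VdstQ ↔ p.Prime ∧ p ≤ 224743) ∧ ¬ d.Lem678 := by
  -- the tower at the level of rational primes, ramified exactly above the primes `≤ 224743`
  let T : PrimeTowerDatum :=
    { W := Nat.Primes, PM := Nat.Primes, PL := Nat.Primes, Ptpd := Nat.Primes, Pmod := Nat.Primes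
      resM := id, resL := id, MtoTpd := id, LtoTpd := id, tpdToMod := id, res_comm := fun _ => rfl
      char := Subtype.val
      Ramified := Subtype.val ⁻¹' {n : ℕ | n ≤ 224743}
      ramified_finite := (Set.finite_Iic 224743).preimage Subtype.val_injective.injOn
      suppM := ∅, suppTpd := ∅, suppL := ∅
      eM := fun _ => 1, eMod := fun _ => 1, fMod := fun _ => 1
      dmod := 1, estar := 2 ^ 12 * 3 ^ 3 * 5, l := 7 }
  have hchar : ∀ v : T.Pmod, (T.char v).Prime := fun v => v.2
  have hV : ∀ p : ℕ, p ∈ T.VdstQ ↔ p.Prime ∧ p ≤ 224743 := by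
    intro p
    rw [T.vdstQ_eq]
    change p ∈ Subtype.val '' (Subtype.val ⁻¹' {n : ℕ | n ≤ 224743} : Set Nat.Primes) ↔ _
    constructor
    · rintro ⟨w, hw, rfl⟩
      exact ⟨w.2, hw⟩
    · rintro ⟨hp, hle⟩
      exact ⟨⟨p, hp⟩, hle, rfl⟩
  -- the carrier, §6.7 slots read through the dictionary
  let d : LocusVolumeDatum :=
    { l := 7, five_le_l := by norm_num, dmod := 1, one_le_dmod := le_rfl
      estar := 2 ^ 12 * 3 ^ 3 * 5, estar_ge := by norm_num, eta := 60, eta_nonneg := by norm_num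
      logDiffTpd := 0, logDiffTpd_nonneg := le_rfl, logCondTpd := 0, logCondTpd_nonneg := le_rfl, logDiffLp := 0
      logq := 0, logq_nonneg := le_rfl
      logsQ := T.logSQ, logsLe := T.logSleQ, Vdst := T.vdstQFinset
      logDiffLpAt := fun _ => 0, logqAt := fun _ => 0, logsQAt := PrimeTowerDatum.logSQAt, logsLeAt := T.logSleQAt
      logVolAt := fun _ => 0, logVolArch := 0, logVolHull := 0, logVolHullFrob := 0
      absLogThetaQ := 1, absLogThetaQ_pos := one_pos, absLogThetaQFrob := 1 }
  have G : PrimeTowerDatum.TowerGlue T d :=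
    { l_eq := rfl, vdst_eq := rfl, logsQ_eq := rfl, logsLe_eq := rfl, logsQAt_eq := fun _ => rfl, logsLeAt_eq := fun _ => rfl }
  have he : d.estar = (T.estar : ℝ) := by
    change (2 ^ 12 * 3 ^ 3 * 5 : ℝ) = ((2 ^ 12 * 3 ^ 3 * 5 : ℕ) : ℝ); norm_num
  refine ⟨T, d, hchar, G, rfl, rfl, rfl, rfl, rfl, rfl, rfl, hV, ?_⟩
  exact G.not_lem678_of_small_l he rfl (by change (7 : ℕ) ≤ 7; exact le_rfl) (by change (60 : ℝ) ≤ 100000; norm_num)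
    fun p hp hle => (hV p).2 ⟨hp, hle⟩

/-! ## 5. THE REPAIR IN THE SPINE: off an exceptional set of bounded height the prime of Lemma 5.8.7 leaves the room -/

open Literature.NumberTheory.DiophantineGeometry Literature.NumberTheory.DiophantineGeometry.GenEll
open Literature.IUT.LogVolume Literature.IUT.LogVolume.Cor22

/-- **The room from the window of Lemma 5.8.7**: if `Q^{1/2} ≥ 3·log(4·C)` (`Q = Tate(C_λ)`, `C > 0`) and `ℓ ≥ Q^{1/2}` (Lemma 5.8.7
(1), first half, inside T-29's `IsLem587Prime`), then `log(4·C·ℓ) ≤ (4/3)·ℓ`. PROVED (`log ℓ ≤ ℓ − 1`). [folklore] -/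
theorem lem678Room_of_isLem587Prime {d : ℕ} {P : NFPoint} {ℓ : ℕ} (h : IsLem587Prime d P ℓ) {C : ℝ} (hC : 0 < C)
    (hQ : 3 * Real.log (4 * C) ≤ Real.sqrt (logQForall P)) : Real.log (4 * C * ℓ) ≤ 4 / 3 * ℓ := by
  have hℓ : (3 * Real.log (4 * C) : ℝ) ≤ ℓ := hQ.trans h.2.1
  have hℓpos : (0 : ℝ) < ℓ := by exact_mod_cast h.1.pos
  rw [Real.log_mul (by positivity) hℓpos.ne']
  have hlogl : Real.log (ℓ : ℝ) ≤ ℓ - 1 := Real.log_le_sub_one_of_pos hℓpos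
  linarith

/-- **Off an exceptional set OF BOUNDED HEIGHT, the prime of Lemma 5.8.7 comes with Thm. 5.7.1's conditions AND the room for
Lemma 6.7.8** (R-J row Y-21g, repair): for `Z` compactly bounded with (5.6.2) and `d ≥ 1` there is `Exc` of bounded height — the
curves with `Tate(C_λ) ≤ max(max(B, 12), (3·log(4·2¹²·3³·5·d))²)`, `B` E-t29's threshold `exists_threshold_P1_to_P6`; bounded height by
Prop. 5.6.1 = `Cor22.partI_holds` — off which every `λ ∈ Z ∩ U(Q̄)_{≤d}` carries `ℓ` with `IsLem587Prime d λ ℓ`, `ITDConditions λ ℓ`,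
`AdmitsCore λ` and `log(4·2¹²·3³·5·d·ℓ) ≤ (4/3)·ℓ`. With `lem678_of_room_of_estar_le` this makes letter g a THEOREM at the genuine `s^≤`
of every carrier glued to such a point's tower (`e_mod ≤ d_mod ≤ d`). PROVED (classical). [claim: Joshi2024ATS4, status: disputed] -/
theorem exists_isLem587Prime_lem678Room_offExc (D : CBData) (hD : Hypotheses D) {d : ℕ} (hd : 0 < d) :
    ∃ Exc : Set NFPoint, (∃ H : ℝ, ∀ P ∈ Exc, P.ht ≤ H) ∧
      ∀ P ∈ D.toSet ∩ UPle d, P ∉ Exc → ∃ ℓ : ℕ, IsLem587Prime d P ℓ ∧ ITDConditions P ℓ ∧ AdmitsCore P ∧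
        Real.log (4 * (2 ^ 12 * 3 ^ 3 * 5 * (d : ℝ)) * ℓ) ≤ 4 / 3 * ℓ := by
  obtain ⟨B, hB⟩ := exists_threshold_P1_to_P6 D hD hd
  obtain ⟨_, h23, h3⟩ := partI_holds D hD
  obtain ⟨C₀, hC₀⟩ := (h3.symm.trans h23.symm).bdLe
  set R : ℝ := 3 * Real.log (4 * (2 ^ 12 * 3 ^ 3 * 5 * (d : ℝ))) with hR
  refine ⟨{P | P ∈ D.toSet ∩ UPle d ∧ logQForall P ≤ max (max B 12) (R ^ 2)}, ⟨1 / 6 * max (max B 12) (R ^ 2) + C₀, ?_⟩, ?_⟩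
  · rintro P ⟨⟨hPD, _⟩, hPB⟩
    have hx : NFPoint.ht P - 1 / 6 * logQForall P ≤ C₀ := hC₀ P hPD
    linarith
  · rintro P ⟨hPD, hPd⟩ hPexc
    have hgt : max (max B 12) (R ^ 2) < logQForall P := by
      by_contra hle
      exact hPexc ⟨⟨hPD, hPd⟩, not_lt.mp hle⟩
    have hBlt : B < logQForall P := lt_of_le_of_lt ((le_max_left _ _).trans (le_max_left _ _)) hgt
    have h12 : (12 : ℝ) < logQForall P := lt_of_le_of_lt ((le_max_right _ _).trans (le_max_left _ _)) hgt
    have hR2 : R ^ 2 < logQForall P := lt_of_le_of_lt (le_max_right _ _) hgt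
    obtain ⟨ℓ, hℓP, h7, hP5, hP6⟩ := hB P ⟨hPD, hPd⟩ hBlt
    have hcore : AdmitsCore P := by
      by_contra hno
      have := logQForall_le_of_not_admitsCore hno
      linarith
    have hdpos : (0 : ℝ) < d := by exact_mod_cast hd
    have hRQ : R ≤ Real.sqrt (logQForall P) := Real.le_sqrt_of_sq_le hR2.le
    exact ⟨ℓ, hℓP, ⟨h7, hℓP.2.2.2.1, hP5, hP6⟩, hcore,
      lem678Room_of_isLem587Prime hℓP (C := 2 ^ 12 * 3 ^ 3 * 5 * (d : ℝ)) (by positivity) hRQ⟩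

end Summit.ABC.IUTFork.Joshi.ATS4

end
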